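import Summits.QuantumFields.YangMills.Theorems.LuscherReductionRunningReductionTraceFormulaKernel
import Mathlib.MeasureTheory.Integral.Pi
import HarnessLib

/-!
# Crux `TwistedTraceScaling` (stmt-QuantumFields-20203), LEAD-KIT §3 A2 — the 4D DICTIONARY: the zero-flux trace `Z_phys(L, β, T)` IS the
# twist-averaged ALL-LINKS Wilson integral on the asymmetric torus `(ℤ/L)³ × (ℤ/T)` (temporal-gauge ⇄ all temporal links, kernel-checked)

Support module of the `FemtoTransferGap` group (fleet service by seat ym-infvol-p2 g7; route `LuscherReduction`, owner ym-beyond-p1, femto rung R2b1;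
owner's LEAD-KIT `pub/ym-beyond/p1-g23-files/LEAD-KIT-20203-twolattice.md` §3 A2 «4D dictionary … land it as `TowerA.physTrace_eq_twistAvg_wilson4D`»).

The tree's zero-flux trace `TT.physTraceSucc L β n` (`Theorems/LuscherReductionRunningReductionTraceFormulaDefs.lean`) is BY DEFINITION Wilson's theory on
`(ℤ/L)³ × (ℤ/(n+1))` in TEMPORAL GAUGE: a closed chain of `n` transfer kernels `K_β(U_t, U_{t+1})` plus ONE seam bond carrying the physical average
`(1/8) Σ_z ∫ K_β(U_n, g · tw_z U_0) dg` (one slice of temporal links `g`, one temporal centre twist `z`).  A renormalisation-group argument (LEAD-KIT strategy A,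
Bałaban blockings on the 4D torus) wants instead the integral over ALL links: spatial slices `U_0 … U_n` AND a temporal link field `g_t` on EVERY slice,
with the slab weight `K_β(U_t, g_t · U_{t+1})` — which, by the definition of `transferKernel` and gauge invariance of the spatial Wilson action, is exactly
`exp` of `β ×` (the temporal plaquettes `Re tr ρ(U_t(e) · (g_t·U_{t+1})(e)⁻¹)` of the slab) minus half the spatial plaquette actions of its two faces — i.e.
the Wilson weight of the slab with temporal links `g_t`.  THIS FILE proves the dictionary

  `physTraceSucc L β n = (1/8) Σ_{z ∈ (ℤ/2)³} wilson4D L β z n`,  `physTrace L β T = (1/8) Σ_z wilson4D L β z (T − 1)`,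

where `wilson4D L β z n := ∫ dU_0…dU_n ∫ dg_0…dg_n ∏_{t ∈ ℤ/(n+1)} K_β(U_t, g_t · tw^{(t)} U_{t+1})` carries the temporal 't Hooft twist `tw_z` on the seam
bond `t = n → 0` only (`tw^{(t)} = id` otherwise).  Mechanism («restore the `n` missing temporal-link slices by Haar-invariant changes of variables»): the
`g_t`-integrals factorise slab by slab into the TWISTED GAUGE-SLAB KERNEL `K^G_z(U,V) := ∫ K_β(U, g · tw_z V) dg` (§1; `K_β^P = (1/8) Σ_z K^G_z`), the cycle
is peeled into iterated kernel operators (Lit `integral_cyclic_het_eq_foldr`, tree pattern `TT.physTraceSucc_eq_integral_iterate_K`), and on PHYSICAL seeds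
(the seam section `K_β^P(·, x)`) the pointwise operators of `K^G_z` and of `K_β` coincide (`∫ K^G_z(U,V) ψ(V) dV = ∫ K_β(U,V) ψ(V) dV` for physical `ψ`:
Fubini, invariance of the a-priori measure under `V ↦ g · tw_z V`, invariance of `ψ` — the per-twist form of the tree's `TT.integral_physAvg_mul_of_isPhys`).

Contents (namespace `…Theorems.FemtoTransferGap.TowerA`):
* §1 `slabKernel β z U V` (= `K^G_z`); `physKernel_eq_avg_slabKernel`; bound, joint measurability; `integral_slabKernel_mul_of_isPhys`;
  `iterate_slabKernelOp_eq` (on a physical seed the `K^G_z`- and `K_β`-iterates coincide).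
* §2 `wilson4D L β z n` (the all-links integral, iterated form `∫ dU (∫ dg …)`); `wilson4D_eq_integral_prod_slabKernel` (Fubini over the `n+1` independent
  temporal link fields, Mathlib `integral_fintype_prod_eq_prod`); `twistAvg_wilson4D_eq` (the twist average closes the seam with `K_β^P`).
* §3 ★ `physTraceSucc_eq_twistAvg_wilson4D`, ★ `physTrace_eq_twistAvg_wilson4D` — the dictionary.

HONEST FRAMING: a fixed-lattice IDENTITY (no estimate, no renormalisation-group content); it serves any 4D approach to the OPEN stub S-TOWER ∕ the uniform
femto trace law of the 20203 lead; femto rung R2b1 only; nothing here bears on infinite volume, the continuum limit in large volume, or the Clay mass gap.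
References: I. Montvay, G. Münster (1994) (3.145) [cite: MontvayMunster1994, (3.145)]; E. Seiler, LNP 159 (1982) §3 [cite: SeilerLNP1982, §3];
M. Lüscher, NPB 219 (1983) §2 [cite: Luscher1983, §2]; G. 't Hooft, NPB 153 (1979) [cite: tHooft1979].
-/

set_option autoImplicit false

noncomputable section

open MeasureTheory Filter Topology Real
open Literature.MathematicalPhysics.QuantumFieldTheory
open Literature.MathematicalPhysics.QuantumLattice
open Literature.Analysis.OperatorTheory.YMMatrixModel
open Literature.Analysis.OperatorTheory
open scoped BigOperators

namespace Summit.QuantumFields.YangMills.Theorems.FemtoTransferGap.TowerA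

open Summit.QuantumFields.YangMills.Theorems.FemtoTransferGap
open Summit.QuantumFields.YangMills.Theorems.FemtoTransferGap.TT
open Summit.QuantumFields.YangMills.Theorems.FemtoTransferGap.PhysL2

variable {L : ℕ} [NeZero L]

/-! ## §1 The twisted gauge-slab kernel `K^G_z(U, V) = ∫ K_β(U, g · tw_z V) dg` -/

/-- **The twisted gauge-slab kernel** `K^G_z(U,V) = ∫ K_β(U, g · tw_z V) dg` (Haar probability on the gauge group of the spatial torus): the weight of
ONE temporal slab of Wilson's theory on `(ℤ/L)³ × ℤ` with its temporal links integrated out, the far face twisted by the temporal centre twist `z`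
(`z = (false,false,false)`: no twist, tree `TT.twist3_false`).  `K_β^P = (1/8) Σ_z K^G_z` (`physKernel_eq_avg_slabKernel`). [cite: SeilerLNP1982, §3] [cite: tHooft1979] -/
def slabKernel (β : ℝ) (z : Fin 3 → Bool) (U V : GaugeConfig 3 L SU2) : ℝ :=
  ∫ g, transferKernel su2Rep β U (gaugeTransform g (twist3 z V)) ∂gaugeMeasure L

/-- `K_β^P(U,V) = (1/8) Σ_z K^G_z(U,V)` (the definition of the physical average, read slab-wise). [cite: Luscher1983, §2] -/
theorem physKernel_eq_avg_slabKernel (β : ℝ) (U V : GaugeConfig 3 L SU2) :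
    physKernel β U V = (1 / 8 : ℝ) * ∑ z : Fin 3 → Bool, slabKernel β z U V :=
  physKernel_apply β U V

/-- **Bound** `|K^G_z(U,V)| ≤ M` from `|K_β| ≤ M`. [folklore] -/
theorem abs_slabKernel_le {β M : ℝ} (hM : ∀ U V : GaugeConfig 3 L SU2, |transferKernel su2Rep β U V| ≤ M)
    (z : Fin 3 → Bool) (U V : GaugeConfig 3 L SU2) : |slabKernel β z U V| ≤ M := by
  haveI := isProbabilityMeasure_gaugeMeasure (L := L)
  have h := norm_integral_le_of_norm_le_const (μ := gaugeMeasure L)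
    (f := fun g => transferKernel su2Rep β U (gaugeTransform g (twist3 z V))) (C := M)
    (ae_of_all _ fun g => by rw [Real.norm_eq_abs]; exact hM _ _)
  rw [probReal_univ, mul_one, Real.norm_eq_abs] at h
  exact h

/-- **Joint measurability** of `K^G_z`. [folklore] -/
theorem measurable_slabKernel_uncurry (β : ℝ) (z : Fin 3 → Bool) :
    Measurable (Function.uncurry (slabKernel (L := L) β z)) := by
  haveI := isProbabilityMeasure_gaugeMeasure (L := L)
  have hK := (stronglyMeasurable_transferKernel (L := L) β).measurable
  have hA : Measurable fun q : (GaugeConfig 3 L SU2 × GaugeConfig 3 L SU2) × (Site 3 L → SU2) => (q.2, q.1.2) :=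
    measurable_snd.prodMk (measurable_snd.comp measurable_fst)
  have hB := (measurable_act_uncurry (L := L) z).comp hA
  have hC := (measurable_fst.comp (measurable_fst (α := GaugeConfig 3 L SU2 × GaugeConfig 3 L SU2)
    (β := Site 3 L → SU2))).prodMk hB
  have h2 := hK.comp hC
  have h3 : StronglyMeasurable (Function.uncurry fun (p : GaugeConfig 3 L SU2 × GaugeConfig 3 L SU2) (g : Site 3 L → SU2) =>
      transferKernel su2Rep β p.1 (gaugeTransform g (twist3 z p.2))) := h2.stronglyMeasurable
  have h4 := StronglyMeasurable.integral_prod_right (ν := gaugeMeasure L) h3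
  exact h4.measurable

/-- Measurability of `a ↦ K^G_z(f a, g a)` along measurable `f, g` (made SYNTACTIC by `simp only`, so that no definitional unfolding of the
integral `slabKernel` is ever attempted by the unifier). [folklore] -/
theorem measurable_slabKernel_comp {α : Type*} [MeasurableSpace α] (β : ℝ) (z : Fin 3 → Bool)
    {f g : α → GaugeConfig 3 L SU2} (hf : Measurable f) (hg : Measurable g) :
    Measurable fun a => slabKernel β z (f a) (g a) := by
  have h := (measurable_slabKernel_uncurry (L := L) β z).comp (hf.prodMk hg)
  simpa only [Function.comp_def, Function.uncurry_apply_pair] using h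

/-- **`K^G_z` acts as `K_β` on physical test functions**: `∫ K^G_z(U,V) ψ(V) dV = ∫ K_β(U,V) ψ(V) dV` for physical `ψ` (Fubini; the a-priori measure is
invariant under `V ↦ g · tw_z V`; `ψ` is invariant).  The per-twist form of the tree's `TT.integral_physAvg_mul_of_isPhys`. [cite: Luscher1983, §2] -/
theorem integral_slabKernel_mul_of_isPhys {β M : ℝ} (hM : ∀ U V : GaugeConfig 3 L SU2, |transferKernel su2Rep β U V| ≤ M)
    {ψ : GaugeConfig 3 L SU2 → ℝ} (hψ : IsPhys ψ) (z : Fin 3 → Bool) (U : GaugeConfig 3 L SU2) :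
    ∫ V, slabKernel β z U V * ψ V ∂configMeasure SU2 L = ∫ V, transferKernel su2Rep β U V * ψ V ∂configMeasure SU2 L := by
  haveI := isProbabilityMeasure_gaugeMeasure (L := L)
  obtain ⟨D, hD⟩ := hψ.bounded
  have hf : Measurable (transferKernel su2Rep β U) := measurable_transferKernel_right β U
  have hM0 : 0 ≤ M := (abs_nonneg _).trans (hM U U)
  have hF : StronglyMeasurable (Function.uncurry fun (V : GaugeConfig 3 L SU2) (g : Site 3 L → SU2) =>
      transferKernel su2Rep β U (gaugeTransform g (twist3 z V)) * ψ V) :=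
    (stronglyMeasurable_act_swap hf z).mul ((hψ.measurable.comp measurable_fst).stronglyMeasurable)
  have hint : Integrable (Function.uncurry fun (V : GaugeConfig 3 L SU2) (g : Site 3 L → SU2) =>
      transferKernel su2Rep β U (gaugeTransform g (twist3 z V)) * ψ V) ((configMeasure SU2 L).prod (gaugeMeasure L)) := by
    refine Integrable.of_bound hF.aestronglyMeasurable (M * D) (ae_of_all _ fun p => ?_)
    rw [Function.uncurry_apply_pair, norm_mul, Real.norm_eq_abs, Real.norm_eq_abs]
    exact mul_le_mul (hM _ _) (hD _) (abs_nonneg _) hM0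
  calc ∫ V, slabKernel β z U V * ψ V ∂configMeasure SU2 L
      = ∫ V, ∫ g, transferKernel su2Rep β U (gaugeTransform g (twist3 z V)) * ψ V ∂gaugeMeasure L ∂configMeasure SU2 L := by
        unfold slabKernel; simp_rw [integral_mul_const]
    _ = ∫ g, ∫ V, transferKernel su2Rep β U (gaugeTransform g (twist3 z V)) * ψ V ∂configMeasure SU2 L ∂gaugeMeasure L :=
        integral_integral_swap hint
    _ = ∫ g, ∫ V, transferKernel su2Rep β U V * ψ V ∂configMeasure SU2 L ∂gaugeMeasure L := by
        refine integral_congr_ae (ae_of_all _ fun g => ?_)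
        have hm : Measurable fun W : GaugeConfig 3 L SU2 => transferKernel su2Rep β U W * ψ W := hf.mul hψ.measurable
        rw [← integral_comp_eq_of_measurePreserving (measurePreserving_act g z) hm]
        refine integral_congr_ae (ae_of_all _ fun V => ?_)
        simp only [act_eq_of_isPhys hψ]
    _ = ∫ V, transferKernel su2Rep β U V * ψ V ∂configMeasure SU2 L := by
        rw [integral_const, probReal_univ, one_smul]

/-- The pointwise operator of `K^G_z` agrees with the transfer operator `K_β` on physical test functions. [cite: Luscher1983, §2] -/
theorem slabKernelOp_eq_transferApply {β M : ℝ} (hM : ∀ U V : GaugeConfig 3 L SU2, |transferKernel su2Rep β U V| ≤ M)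
    {ψ : GaugeConfig 3 L SU2 → ℝ} (hψ : IsPhys ψ) (z : Fin 3 → Bool) :
    (fun U => ∫ V, slabKernel β z U V * ψ V ∂configMeasure SU2 L) = transferApply β ψ := by
  funext U
  rw [integral_slabKernel_mul_of_isPhys hM hψ, transferApply_apply]

/-- **Iterates**: on a physical seed the iterated pointwise operators of `K^G_z` and of `K_β` coincide (the `K_β`-iterates stay physical,
`TT.iterate_physKernelOp_eq`). [cite: Luscher1983, §2] -/
theorem iterate_slabKernelOp_eq {β M : ℝ} (hM : ∀ U V : GaugeConfig 3 L SU2, |transferKernel su2Rep β U V| ≤ M)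
    {ψ : GaugeConfig 3 L SU2 → ℝ} (hψ : IsPhys ψ) (z : Fin 3 → Bool) (m : ℕ) :
    (fun f : GaugeConfig 3 L SU2 → ℝ => fun U => ∫ V, slabKernel β z U V * f V ∂configMeasure SU2 L)^[m] ψ =
      (fun f : GaugeConfig 3 L SU2 → ℝ => fun U => ∫ V, transferKernel su2Rep β U V * f V ∂configMeasure SU2 L)^[m] ψ := by
  induction m with
  | zero => rfl
  | succ m ih =>
    have ih2 := (iterate_physKernelOp_eq hM hψ m).2
    have hK : (fun f : GaugeConfig 3 L SU2 → ℝ => fun U => ∫ V, transferKernel su2Rep β U V * f V ∂configMeasure SU2 L)^[m + 1] ψ =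
        transferApply β ((fun f : GaugeConfig 3 L SU2 → ℝ => fun U => ∫ V, transferKernel su2Rep β U V * f V ∂configMeasure SU2 L)^[m] ψ) := by
      rw [Function.iterate_succ_apply']
      funext U
      rw [transferApply_apply]
    rw [Function.iterate_succ_apply', ih, slabKernelOp_eq_transferApply hM ih2 z, hK]

/-! ## §2 The all-links 4D Wilson integral with temporal twist `z`, and its slab-kernel forms -/

/-- **The all-links Wilson integral** on the asymmetric torus `(ℤ/L)³ × (ℤ/(n+1))` with the temporal 't Hooft twist `z` on the seam bond `n → 0`:
spatial slices `Us t`, a temporal link field `gs t` on every slice, weight `∏_t K_β(Us t, gs t · tw^{(t)} Us (t+1))` (`tw^{(n)} = tw_z`, `tw^{(t)} = id`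
for `t < n`; indices in `ℤ/(n+1)`, so `n + 1 = 0`); a-priori measures = products of Haar probabilities (`configMeasure`, `gaugeMeasure`); written as the
iterated integral `∫ dU (∫ dg …)`.  By the definition of `transferKernel`, `K_β(U, g · V) = exp(β Σ_e Re tr ρ(U_e (g·V)_e⁻¹) − (β/2)(S(U) + S(V)))` is the
Wilson weight of the slab with temporal links `g` (tree normalisation of `FemtoTransferGap.transferKernel`). [cite: MontvayMunster1994, (3.145)] [cite: tHooft1979] -/
def wilson4D (L : ℕ) [NeZero L] (β : ℝ) (z : Fin 3 → Bool) (n : ℕ) : ℝ :=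
  ∫ Us : Fin (n + 1) → GaugeConfig 3 L SU2,
    ∫ gs : Fin (n + 1) → (Site 3 L → SU2),
      ∏ i : Fin (n + 1), transferKernel su2Rep β (Us i)
        (gaugeTransform (gs i) (twist3 (if i = Fin.last n then z else fun _ => false) (Us (i + 1))))
      ∂(Measure.pi fun _ : Fin (n + 1) => gaugeMeasure L)
    ∂(Measure.pi fun _ : Fin (n + 1) => configMeasure SU2 L)

/-- **Integrating out the temporal links slab by slab** (they are independent): `wilson4D L β z n = ∫ ∏_t K^G_{z_t}(Us t, Us (t+1)) dU` with `z_n = z`,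
`z_t =` no twist for `t < n` (Mathlib `integral_fintype_prod_eq_prod`). [folklore] -/
theorem wilson4D_eq_integral_prod_slabKernel (β : ℝ) (z : Fin 3 → Bool) (n : ℕ) :
    wilson4D L β z n =
      ∫ Us : Fin (n + 1) → GaugeConfig 3 L SU2,
        ∏ i : Fin (n + 1), slabKernel β (if i = Fin.last n then z else fun _ => false) (Us i) (Us (i + 1))
        ∂(Measure.pi fun _ : Fin (n + 1) => configMeasure SU2 L) := by
  haveI := isProbabilityMeasure_gaugeMeasure (L := L)
  unfold wilson4D
  refine integral_congr_ae (ae_of_all _ fun Us => ?_)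
  exact integral_fintype_prod_eq_prod (𝕜 := ℝ) (μ := fun _ : Fin (n + 1) => gaugeMeasure L)
    (fun i (g : Site 3 L → SU2) => transferKernel su2Rep β (Us i)
      (gaugeTransform g (twist3 (if i = Fin.last n then z else fun _ => false) (Us (i + 1)))))

/-- Splitting off the seam bond: `∏_{t ∈ ℤ/(n+1)} K^G_{z_t}(Us t, Us (t+1)) = (∏_{t<n} K^G_0(Us t, Us (t+1))) · K^G_z(Us n, Us 0)`. [folklore] -/
theorem prod_slabKernel_split (β : ℝ) (z : Fin 3 → Bool) (n : ℕ) (Us : Fin (n + 1) → GaugeConfig 3 L SU2) :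
    ∏ i : Fin (n + 1), slabKernel β (if i = Fin.last n then z else fun _ => false) (Us i) (Us (i + 1)) =
      (∏ i : Fin n, slabKernel β (fun _ => false) (Us i.castSucc) (Us i.succ)) * slabKernel β z (Us (Fin.last n)) (Us 0) := by
  rw [Fin.prod_univ_castSucc]
  have h1 : (∏ i : Fin n, slabKernel β (if (Fin.castSucc i : Fin (n + 1)) = Fin.last n then z else fun _ => false)
      (Us (Fin.castSucc i)) (Us (Fin.castSucc i + 1))) = ∏ i : Fin n, slabKernel β (fun _ => false) (Us i.castSucc) (Us i.succ) := by
    refine Finset.prod_congr rfl fun i _ => ?_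
    have hi : (Fin.castSucc i : Fin (n + 1)) ≠ Fin.last n := (Fin.castSucc_lt_last i).ne
    rw [if_neg hi, Fin.coeSucc_eq_succ]
  have h2 : slabKernel β (if (Fin.last n : Fin (n + 1)) = Fin.last n then z else fun _ => false) (Us (Fin.last n)) (Us (Fin.last n + 1)) =
      slabKernel β z (Us (Fin.last n)) (Us 0) := by
    rw [if_pos rfl, Fin.last_add_one]
  rw [h1, h2]

/-- Measurability of the open chain `Us ↦ ∏_{t<n} K^G_0(Us t, Us (t+1))`. [folklore] -/
theorem measurable_chain (β : ℝ) (n : ℕ) :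
    Measurable fun Us : Fin (n + 1) → GaugeConfig 3 L SU2 =>
      ∏ i : Fin n, slabKernel β (fun _ => false) (Us i.castSucc) (Us i.succ) := by
  refine Finset.measurable_prod _ fun i _ => ?_
  exact measurable_slabKernel_comp β (fun _ => false)
    (measurable_pi_apply (X := fun _ : Fin (n + 1) => GaugeConfig 3 L SU2) (Fin.castSucc i))
    (measurable_pi_apply (X := fun _ : Fin (n + 1) => GaugeConfig 3 L SU2) (Fin.succ i))

/-- Bound of the open chain: `|∏_{t<n} K^G_0(Us t, Us (t+1))| ≤ M^n`. [folklore] -/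
theorem abs_chain_le {β M : ℝ} (hM : ∀ U V : GaugeConfig 3 L SU2, |transferKernel su2Rep β U V| ≤ M) (n : ℕ)
    (Us : Fin (n + 1) → GaugeConfig 3 L SU2) :
    |∏ i : Fin n, slabKernel β (fun _ => false) (Us i.castSucc) (Us i.succ)| ≤ M ^ n := by
  rw [Finset.abs_prod]
  calc ∏ i : Fin n, |slabKernel β (fun _ => false) (Us i.castSucc) (Us i.succ)|
      ≤ ∏ _i : Fin n, M := Finset.prod_le_prod (fun i _ => abs_nonneg _) fun i _ => abs_slabKernel_le hM _ _ _
    _ = M ^ n := by simp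

/-- **The twist average closes the seam with `K_β^P`**: `(1/8) Σ_z wilson4D L β z n = ∫ (∏_{t<n} K^G_0(Us t, Us (t+1))) · K_β^P(Us n, Us 0) dU`.
[cite: MontvayMunster1994, (3.145)] [cite: Luscher1983, §2] -/
theorem twistAvg_wilson4D_eq (β : ℝ) (n : ℕ) :
    (1 / 8 : ℝ) * ∑ z : Fin 3 → Bool, wilson4D L β z n =
      ∫ Us : Fin (n + 1) → GaugeConfig 3 L SU2,
        (∏ i : Fin n, slabKernel β (fun _ => false) (Us i.castSucc) (Us i.succ)) * physKernel β (Us (Fin.last n)) (Us 0)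
        ∂(Measure.pi fun _ : Fin (n + 1) => configMeasure SU2 L) := by
  obtain ⟨M, hM0, hM⟩ := exists_abs_transferKernel_le (L := L) β
  simp_rw [wilson4D_eq_integral_prod_slabKernel, prod_slabKernel_split]
  -- integrability of each twisted term
  have hint : ∀ z : Fin 3 → Bool, Integrable (fun Us : Fin (n + 1) → GaugeConfig 3 L SU2 =>
      (∏ i : Fin n, slabKernel β (fun _ => false) (Us i.castSucc) (Us i.succ)) * slabKernel β z (Us (Fin.last n)) (Us 0))
      (Measure.pi fun _ : Fin (n + 1) => configMeasure SU2 L) := by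
    intro z
    have hm : Measurable fun Us : Fin (n + 1) → GaugeConfig 3 L SU2 =>
        (∏ i : Fin n, slabKernel β (fun _ => false) (Us i.castSucc) (Us i.succ)) * slabKernel β z (Us (Fin.last n)) (Us 0) :=
      (measurable_chain β n).mul (measurable_slabKernel_comp β z
        (measurable_pi_apply (X := fun _ : Fin (n + 1) => GaugeConfig 3 L SU2) (Fin.last n))
        (measurable_pi_apply (X := fun _ : Fin (n + 1) => GaugeConfig 3 L SU2) 0))
    refine Integrable.of_bound hm.aestronglyMeasurable (M ^ n * M) (ae_of_all _ fun Us => ?_)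
    rw [Real.norm_eq_abs, abs_mul]
    exact mul_le_mul (abs_chain_le hM n Us) (abs_slabKernel_le hM z _ _) (abs_nonneg _) (pow_nonneg hM0 n)
  rw [← integral_finsetSum _ fun z _ => hint z, ← integral_const_mul]
  refine integral_congr_ae (ae_of_all _ fun Us => ?_)
  dsimp only
  rw [physKernel_eq_avg_slabKernel, ← Finset.mul_sum]
  ring

/-! ## §3 The dictionary -/

omit [NeZero L] in
/-- The integrand of the closed form as a cyclic product of `m+1` bonds `K^G_0` and one bond `K_β^P` (pattern `TT.physTraceSucc_integrand_eq`). [folklore] -/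
theorem chain_integrand_eq [NeZero L] (β : ℝ) (m : ℕ) (V : Fin (m + 2) → GaugeConfig 3 L SU2) :
    (∏ i : Fin (m + 1), slabKernel β (fun _ => false) (V i.castSucc) (V i.succ)) * physKernel β (V (Fin.last (m + 1))) (V 0) =
      ∏ t : Fin (m + 2), (fun s : ℕ => if s = m + 1 then physKernel (L := L) β else slabKernel β (fun _ => false)) t (V t) (V (t + 1)) := by
  symm
  rw [Fin.prod_univ_castSucc]
  congr 1
  · refine Finset.prod_congr rfl fun i _ => ?_
    have hi : ((Fin.castSucc i : Fin (m + 2)) : ℕ) ≠ m + 1 := by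
      rw [Fin.val_castSucc]; exact ne_of_lt i.isLt
    simp only [hi, if_false, Fin.coeSucc_eq_succ]
  · simp only [Fin.val_last, if_true, Fin.last_add_one]

/-- **Peeling the all-links cycle**: for `m + 2` slices the closed form is the diagonal integral of the `(m+1)`-st `K^G_0`-iterate of the physical
section `K_β^P(·, x)` (Lit `integral_cyclic_het_eq_foldr`; pattern `TT.physTraceSucc_eq_integral_iterate_K`). [cite: MontvayMunster1994, (3.145)] -/
theorem chain_eq_integral_iterate {β M : ℝ} (hM : ∀ U V : GaugeConfig 3 L SU2, |transferKernel su2Rep β U V| ≤ M) (m : ℕ) :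
    ∫ Us : Fin (m + 2) → GaugeConfig 3 L SU2,
        (∏ i : Fin (m + 1), slabKernel β (fun _ => false) (Us i.castSucc) (Us i.succ)) * physKernel β (Us (Fin.last (m + 1))) (Us 0)
        ∂(Measure.pi fun _ : Fin (m + 2) => configMeasure SU2 L) =
      ∫ x, ((fun f : GaugeConfig 3 L SU2 → ℝ => fun w => ∫ y, slabKernel β (fun _ => false) w y * f y ∂configMeasure SU2 L)^[m + 1]
        (fun y => physKernel β y x)) x ∂configMeasure SU2 L := by
  set κ : ℕ → GaugeConfig 3 L SU2 → GaugeConfig 3 L SU2 → ℝ :=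
    fun s => if s = m + 1 then physKernel (L := L) β else slabKernel β (fun _ => false) with hκdef
  have hκ : ∀ t, Measurable (Function.uncurry (κ t)) := fun t => by
    by_cases ht : t = m + 1
    · simp only [hκdef, ht, if_true]; exact (stronglyMeasurable_physKernel (L := L) β).measurable
    · simp only [hκdef, ht, if_false]; exact measurable_slabKernel_uncurry (L := L) β _
  have hC : ∀ t x y, ‖κ t x y‖ ≤ M := fun t x y => by
    rw [Real.norm_eq_abs]
    by_cases ht : t = m + 1
    · simp only [hκdef, ht, if_true]; exact abs_physKernel_le hM x y
    · simp only [hκdef, ht, if_false]; exact abs_slabKernel_le hM _ x y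
  have h1 : ∫ Us : Fin (m + 2) → GaugeConfig 3 L SU2,
        (∏ i : Fin (m + 1), slabKernel β (fun _ => false) (Us i.castSucc) (Us i.succ)) * physKernel β (Us (Fin.last (m + 1))) (Us 0)
        ∂(Measure.pi fun _ : Fin (m + 2) => configMeasure SU2 L) =
      ∫ V : Fin (m + 2) → GaugeConfig 3 L SU2, ∏ t : Fin (m + 2), κ t (V t) (V (t + 1)) ∂(Measure.pi fun _ => configMeasure SU2 L) := by
    refine integral_congr_ae (ae_of_all _ fun V => ?_)
    exact chain_integrand_eq β m V
  have h2 := integral_cyclic_congr_fin (L := L) (show m + 2 = 1 + m + 1 by omega) κ (configMeasure SU2 L)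
  have h3 := integral_cyclic_het_eq_foldr (ρ := configMeasure SU2 L) hκ hC m
  rw [h1, h2, h3]
  refine integral_congr_ae (ae_of_all _ fun x => ?_)
  dsimp only
  have hlast : κ (m + 1) = physKernel (L := L) β := by simp [hκdef]
  have h4 := foldr_op_eq_iterate_of_eq (ρ := configMeasure SU2 L) κ (slabKernel β (fun _ => false)) (m + 1) 0
    (fun i hi => by simp [hκdef, Nat.ne_of_lt hi]) (fun w => κ (m + 1) w x)
  simp only [Nat.add_zero] at h4
  rw [h4, hlast]

/-- ★ **THE 4D DICTIONARY.**  `Z_phys(L, β, n+1) = (1/8) Σ_{z ∈ (ℤ/2)³} wilson4D L β z n`: the tree's zero-flux trace of `n+1` transfer steps (temporal gauge,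
one seam slice of temporal links, twist-averaged seam) equals the twist average of the ALL-LINKS Wilson integrals on `(ℤ/L)³ × (ℤ/(n+1))` with temporal
twist `z` — the `n` missing temporal-link slices are restored by Haar-invariant changes of variables (§1–§2).  [cite: MontvayMunster1994, (3.145)]
[cite: SeilerLNP1982, §3] [cite: tHooft1979] -/
theorem physTraceSucc_eq_twistAvg_wilson4D (β : ℝ) (n : ℕ) :
    physTraceSucc L β n = (1 / 8 : ℝ) * ∑ z : Fin 3 → Bool, wilson4D L β z n := by
  obtain ⟨M, -, hM⟩ := exists_abs_transferKernel_le (L := L) β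
  rw [twistAvg_wilson4D_eq]
  cases n with
  | zero =>
    unfold physTraceSucc
    refine integral_congr_ae (ae_of_all _ fun Us => ?_)
    simp only [Finset.univ_eq_empty, Finset.prod_empty, one_mul]
    rfl
  | succ m =>
    rw [chain_eq_integral_iterate hM m, physTraceSucc_eq_integral_iterate_K hM m]
    refine integral_congr_ae (ae_of_all _ fun x => ?_)
    dsimp only
    rw [iterate_slabKernelOp_eq hM (isPhys_physKernel_left hM x) _ (m + 1)]

/-- ★ **THE 4D DICTIONARY for `Z_phys(L, β, T)`, `T ≥ 1`** (and, by the tree's junk convention `physTrace L β 0 = physTraceSucc L β 0`, also at `T = 0`):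
`TT.physTrace L β T = (1/8) Σ_z wilson4D L β z (T − 1)`.  LEAD-KIT 20203 §3 A2. [cite: MontvayMunster1994, (3.145)] [cite: tHooft1979] -/
theorem physTrace_eq_twistAvg_wilson4D (β : ℝ) (T : ℕ) :
    physTrace L β T = (1 / 8 : ℝ) * ∑ z : Fin 3 → Bool, wilson4D L β z (T - 1) :=
  physTraceSucc_eq_twistAvg_wilson4D β (T - 1)

end Summit.QuantumFields.YangMills.Theorems.FemtoTransferGap.TowerA

end
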